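import Summits.ResolutionOfSingularities.ResolutionOfSingularities.Theorems.EquisingularLiftEquisingularLiftNatOrdinaryPoint
import Mathlib.RingTheory.Polynomial.GaussLemma
import Mathlib.Algebra.Polynomial.FieldDivision
import HarnessLib

/-!
# [OURS · L1 W4.5(b)] SPECIMEN: THE ONE-NODAL CUBIC SURFACE `x₀(x₁² + x₂² + x₃²) + x₁³ + x₂³ + x₃³ = 0` ⊂ ℙ³ satisfies EL♮ (`p ≠ 2, 3`)
# — the first NON-CONICAL instance of the ordinary-point rung T-ORD (crux `Theses.EquisingularLift.EquisingularLiftNat`, stmt-ResolutionOfSingularities-20038)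

NOT a statement of any manuscript; OURS kernel specimen (cell `res-hironaka`, chain w45b; seat res-D-pv-013, own initiative, counted 0). AI-written, weaker
than expert review. Two small `def`s (the form and its affine chart equation), no `sorry`, standard axioms.

`F = x₀·q(x₁,x₂,x₃) + c(x₁,x₂,x₃)`, `q = Σ xᵢ²`, `c = Σ xᵢ³`: a cubic surface with an ordinary double point (node, `A₁`) at `P = [1:0:0:0]` — tangent cone
the smooth conic `q` — and NO other singular point when `2, 3 ≠ 0` in `K` (the three affine charts `x_c = 1`, `c = 1,2,3`, all have the equation
`f = y₀(1 + y₁² + y₂²) + 1 + y₁³ + y₂³`, whose Jacobian ideal is the unit ideal: `isRegularRing_quotient_chartEqn`, prime by prime). `F` is prime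
(degree one in `x₀` with coprime coefficients: Gauss). Hence `OrdPoint.elNatAt_ordinaryPoint` (p545486) applies: **`NodalCubic.elNatAt_nodalCubic`**.
It is NOT a cone (`Ψ = c ≠ 0`), so this is the first instance of T-ORD beyond `ConeN.elNatAt_cone`.
-/

set_option linter.dupNamespace false -- mandated namespace `Summit.<Summit>.<Problem>` of this single-conjunct summit

noncomputable section

open CategoryTheory AlgebraicGeometry MvPolynomial
open Literature.AlgebraicGeometry.Resolution
open Literature.AlgebraicGeometry.Motives Literature.AlgebraicGeometry.Motives.SmoothHypersurface
open Literature.AlgebraicGeometry.Motives.ProjectiveSpace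
open Summit.ResolutionOfSingularities.ResolutionOfSingularities.Theorems.EquisingularLift.SpecimenQuartic

namespace Summit.ResolutionOfSingularities.ResolutionOfSingularities.Cruxes.EquisingularLiftNat.Sections

namespace NodalCubic

variable (K : Type) [Field K]

/-- The Fermat quadric `q = y₀² + y₁² + y₂²` (the tangent cone at the node) — written as the tree's `∑ Xᵢ^2`. [folklore] -/
theorem isHomogeneous_quadric : (∑ i : Fin 3, (X i : MvPolynomial (Fin 3) K) ^ 2).IsHomogeneous 2 :=
  IsHomogeneous.sum _ _ _ fun i _ => by simpa using (isHomogeneous_X K i).pow 2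

/-- **The nodal cubic form** `F = x₀·(x₁² + x₂² + x₃²) + (x₁³ + x₂³ + x₃³) ∈ K[x₀,…,x₃]`, as `x₀·q(x₁,x₂,x₃) + c(x₁,x₂,x₃)`. [folklore] -/
def form : MvPolynomial (Fin (1 + 2 + 1)) K :=
  X 0 * rename Fin.succ (∑ i : Fin 3, (X i : MvPolynomial (Fin 3) K) ^ 2) + rename Fin.succ (∑ i : Fin 3, (X i : MvPolynomial (Fin 3) K) ^ 3)

/-- **The common affine chart equation** `f = y₀(1 + y₁² + y₂²) + (1 + y₁³ + y₂³)` of the three charts `x_c = 1`, `c = 1, 2, 3`. [folklore] -/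
def chartEqn : MvPolynomial (Fin 3) K :=
  X 0 * (1 + X 1 ^ 2 + X 2 ^ 2) + (1 + X 1 ^ 3 + X 2 ^ 3)

/-- `F` is homogeneous of degree `3`. [folklore] -/
theorem isHomogeneous_form : (form K).IsHomogeneous 3 := by
  have hq : (rename Fin.succ (∑ i : Fin 3, (X i : MvPolynomial (Fin 3) K) ^ 2) : MvPolynomial (Fin (1 + 2 + 1)) K).IsHomogeneous 2 :=
    (isHomogeneous_quadric K).rename_isHomogeneous
  have hc : (rename Fin.succ (∑ i : Fin 3, (X i : MvPolynomial (Fin 3) K) ^ 3) : MvPolynomial (Fin (1 + 2 + 1)) K).IsHomogeneous 3 :=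
    (IsHomogeneous.sum _ _ _ fun i _ => by simpa using (isHomogeneous_X K i).pow 3).rename_isHomogeneous
  have h0 : ((X 0 : MvPolynomial (Fin (1 + 2 + 1)) K) * rename Fin.succ (∑ i : Fin 3, (X i : MvPolynomial (Fin 3) K) ^ 2)).IsHomogeneous 3 := by
    simpa using (isHomogeneous_X K 0).mul hq
  exact h0.add hc

/-- `F ∈ (x₁, x₂, x₃)`: the vertex `[1:0:0:0]` lies on the surface. [folklore] -/
theorem form_mem_span : form K ∈ Ideal.span (Set.range fun j : Fin (1 + 2) => (X j.succ : MvPolynomial (Fin (1 + 2 + 1)) K)) := by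
  refine Ideal.add_mem _ (Ideal.mul_mem_left _ _ (ConeN.rename_succ_mem_span_X_succ K _ (isHomogeneous_quadric K) two_pos))
    (ConeN.rename_succ_mem_span_X_succ K _ (IsHomogeneous.sum _ _ _ fun i _ => by simpa using (isHomogeneous_X K i).pow 3) three_pos)

/-- **The vertex chart**: `F(x₀ := 1) = q + c`. [folklore] -/
theorem dehomogenize_zero_form : dehomogenize K (0 : Fin (1 + 2 + 1)) (form K) =
    (∑ i : Fin 3, (X i : MvPolynomial (Fin 3) K) ^ 2) + ∑ i : Fin 3, (X i : MvPolynomial (Fin 3) K) ^ 3 := by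
  rw [form, map_add, map_mul, dehomogenize_X_self, one_mul, ConeN.dehomogenize_zero_rename_succ, ConeN.dehomogenize_zero_rename_succ]

/-- The cubic part lies in `(y)³`. [folklore] -/
theorem cubes_mem_pow : (∑ i : Fin 3, (X i : MvPolynomial (Fin 3) K) ^ 3) ∈
    Ideal.span (Set.range (X : Fin 3 → MvPolynomial (Fin 3) K)) ^ (2 + 1) :=
  Ideal.sum_mem _ fun i _ => Ideal.pow_mem_pow (Ideal.subset_span (Set.mem_range_self i)) _

/-! ## The charts off the vertex: `F(x_c := 1) = f` for `c = 1, 2, 3` -/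

/-- `F` written out in the variables of `ℙ³`. [folklore] -/
theorem form_eq : form K = X 0 * (X 1 ^ 2 + X 2 ^ 2 + X 3 ^ 2) + (X 1 ^ 3 + X 2 ^ 3 + X 3 ^ 3) := by
  simp only [form, Fin.sum_univ_three, map_add, map_pow, rename_X]
  rfl

/-- `F(x₁ := 1) = f`. [folklore] -/
theorem dehomogenize_one_form : dehomogenize K (1 : Fin (1 + 2 + 1)) (form K) = chartEqn K := by
  have h0 : dehomogenize K (1 : Fin (1 + 2 + 1)) (X 0) = X 0 := by
    rw [show (0 : Fin (1 + 2 + 1)) = (1 : Fin (1 + 2 + 1)).succAbove 0 from by decide, dehomogenize_X_succAbove]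
  have h2 : dehomogenize K (1 : Fin (1 + 2 + 1)) (X 2) = X 1 := by
    rw [show (2 : Fin (1 + 2 + 1)) = (1 : Fin (1 + 2 + 1)).succAbove 1 from by decide, dehomogenize_X_succAbove]
  have h3 : dehomogenize K (1 : Fin (1 + 2 + 1)) (X 3) = X 2 := by
    rw [show (3 : Fin (1 + 2 + 1)) = (1 : Fin (1 + 2 + 1)).succAbove 2 from by decide, dehomogenize_X_succAbove]
  rw [form_eq]
  simp only [map_add, map_mul, map_pow, h0, dehomogenize_X_self, h2, h3, chartEqn]
  ring

/-- `F(x₂ := 1) = f`. [folklore] -/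
theorem dehomogenize_two_form : dehomogenize K (2 : Fin (1 + 2 + 1)) (form K) = chartEqn K := by
  have h0 : dehomogenize K (2 : Fin (1 + 2 + 1)) (X 0) = X 0 := by
    rw [show (0 : Fin (1 + 2 + 1)) = (2 : Fin (1 + 2 + 1)).succAbove 0 from by decide, dehomogenize_X_succAbove]
  have h1 : dehomogenize K (2 : Fin (1 + 2 + 1)) (X 1) = X 1 := by
    rw [show (1 : Fin (1 + 2 + 1)) = (2 : Fin (1 + 2 + 1)).succAbove 1 from by decide, dehomogenize_X_succAbove]
  have h3 : dehomogenize K (2 : Fin (1 + 2 + 1)) (X 3) = X 2 := by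
    rw [show (3 : Fin (1 + 2 + 1)) = (2 : Fin (1 + 2 + 1)).succAbove 2 from by decide, dehomogenize_X_succAbove]
  rw [form_eq]
  simp only [map_add, map_mul, map_pow, h0, h1, dehomogenize_X_self, h3, chartEqn]
  ring

/-- `F(x₃ := 1) = f`. [folklore] -/
theorem dehomogenize_three_form : dehomogenize K (3 : Fin (1 + 2 + 1)) (form K) = chartEqn K := by
  have h0 : dehomogenize K (3 : Fin (1 + 2 + 1)) (X 0) = X 0 := by
    rw [show (0 : Fin (1 + 2 + 1)) = (3 : Fin (1 + 2 + 1)).succAbove 0 from by decide, dehomogenize_X_succAbove]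
  have h1 : dehomogenize K (3 : Fin (1 + 2 + 1)) (X 1) = X 1 := by
    rw [show (1 : Fin (1 + 2 + 1)) = (3 : Fin (1 + 2 + 1)).succAbove 1 from by decide, dehomogenize_X_succAbove]
  have h2 : dehomogenize K (3 : Fin (1 + 2 + 1)) (X 2) = X 2 := by
    rw [show (2 : Fin (1 + 2 + 1)) = (3 : Fin (1 + 2 + 1)).succAbove 2 from by decide, dehomogenize_X_succAbove]
  rw [form_eq]
  simp only [map_add, map_mul, map_pow, h0, h1, h2, dehomogenize_X_self, chartEqn]
  ring

/-! ## The chart equation `f` has the unit Jacobian ideal: `K[y]/(f)` is a regular ring (`2, 3 ≠ 0`) -/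

/-- **`K[y₀,y₁,y₂]/(f)` is a regular ring for `f = y₀(1 + y₁² + y₂²) + 1 + y₁³ + y₂³`** when `2 ≠ 0` and `3 ≠ 0` in `K`: at a prime `Q ∋ f` containing
`∂₀f = 1 + y₁² + y₂²`, `∂₁f = y₁(2y₀ + 3y₁)`, `∂₂f = y₂(2y₀ + 3y₂)` one derives `2 ∈ Q` or `3 ∈ Q` (four cases on the prime factors), so some partial
avoids `Q` (Stacks 07PF). [cite: StacksProject, Tag 07PF] -/
theorem isRegularRing_quotient_chartEqn (h2 : (2 : K) ≠ 0) (h3 : (3 : K) ≠ 0) :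
    IsRegularRing (MvPolynomial (Fin 3) K ⧸ Ideal.span {chartEqn K}) := by
  refine isRegularRing_quotient_of_derivations (S₀ := K) _ fun Q hQ hfQ => ?_
  by_contra hnone
  push Not at hnone
  have hd0 : pderiv 0 (chartEqn K) = 1 + X 1 ^ 2 + X 2 ^ 2 := by
    simp only [chartEqn, map_add, Derivation.leibniz, Derivation.leibniz_pow, pderiv_X_self, pderiv_X_of_ne (show (1 : Fin 3) ≠ 0 by decide),
      pderiv_X_of_ne (show (2 : Fin 3) ≠ 0 by decide), smul_eq_mul, Derivation.map_one_eq_zero]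
    ring
  have hd1 : pderiv 1 (chartEqn K) = X 1 * (2 * X 0 + 3 * X 1) := by
    simp only [chartEqn, map_add, Derivation.leibniz, Derivation.leibniz_pow, pderiv_X_self, pderiv_X_of_ne (show (0 : Fin 3) ≠ 1 by decide),
      pderiv_X_of_ne (show (2 : Fin 3) ≠ 1 by decide), smul_eq_mul, Derivation.map_one_eq_zero]
    ring
  have hd2 : pderiv 2 (chartEqn K) = X 2 * (2 * X 0 + 3 * X 2) := by
    simp only [chartEqn, map_add, Derivation.leibniz, Derivation.leibniz_pow, pderiv_X_self, pderiv_X_of_ne (show (0 : Fin 3) ≠ 2 by decide),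
      pderiv_X_of_ne (show (1 : Fin 3) ≠ 2 by decide), smul_eq_mul, Derivation.map_one_eq_zero]
    ring
  have hs : (1 + X 1 ^ 2 + X 2 ^ 2 : MvPolynomial (Fin 3) K) ∈ Q := hd0 ▸ hnone (pderiv 0)
  have hu1 : (X 1 * (2 * X 0 + 3 * X 1) : MvPolynomial (Fin 3) K) ∈ Q := hd1 ▸ hnone (pderiv 1)
  have hu2 : (X 2 * (2 * X 0 + 3 * X 2) : MvPolynomial (Fin 3) K) ∈ Q := hd2 ▸ hnone (pderiv 2)
  have ht : (1 + X 1 ^ 3 + X 2 ^ 3 : MvPolynomial (Fin 3) K) ∈ Q := by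
    have h := Q.sub_mem hfQ (Q.mul_mem_left (X 0) hs)
    rwa [show chartEqn K - X 0 * (1 + X 1 ^ 2 + X 2 ^ 2) = 1 + X 1 ^ 3 + X 2 ^ 3 from by rw [chartEqn]; ring] at h
  -- units
  have hunit : ∀ {a : K}, a ≠ 0 → (C a : MvPolynomial (Fin 3) K) ∈ Q → False := fun ha haQ =>
    hQ.ne_top (Q.eq_top_of_isUnit_mem haQ ((IsUnit.mk0 _ ha).map C))
  have hC2 : (C (2 : K) : MvPolynomial (Fin 3) K) = 2 := map_ofNat C 2
  have hC3 : (C (3 : K) : MvPolynomial (Fin 3) K) = 3 := map_ofNat C 3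
  -- one coordinate in `Q`: then `2 ∈ Q`
  have case1 : ∀ {a b : MvPolynomial (Fin 3) K}, a ∈ Q → 1 + a ^ 2 + b ^ 2 ∈ Q → 1 + a ^ 3 + b ^ 3 ∈ Q → False := by
    intro a b ha hs' ht'
    have h1 : 1 + b ^ 2 ∈ Q := by
      have h := Q.sub_mem hs' (Q.mul_mem_left a ha)
      rwa [show 1 + a ^ 2 + b ^ 2 - a * a = 1 + b ^ 2 from by ring] at h
    have h2' : 1 + b ^ 3 ∈ Q := by
      have h := Q.sub_mem ht' (Q.mul_mem_left (a ^ 2) ha)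
      rwa [show 1 + a ^ 3 + b ^ 3 - a ^ 2 * a = 1 + b ^ 3 from by ring] at h
    have h3' : b - 1 ∈ Q := by
      have h := Q.sub_mem (Q.mul_mem_left b h1) h2'
      rwa [show b * (1 + b ^ 2) - (1 + b ^ 3) = b - 1 from by ring] at h
    have h4 : (2 : MvPolynomial (Fin 3) K) ∈ Q := by
      have h := Q.sub_mem h1 (Q.mul_mem_left (b + 1) h3')
      rwa [show 1 + b ^ 2 - (b + 1) * (b - 1) = 2 from by ring] at h
    exact hunit h2 (hC2 ▸ h4)
  rcases hQ.mem_or_mem hu1 with hx1 | hv1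
  · exact case1 hx1 hs ht
  rcases hQ.mem_or_mem hu2 with hx2 | hv2
  · exact case1 hx2 (by rw [show (1 + X 2 ^ 2 + X 1 ^ 2 : MvPolynomial (Fin 3) K) = 1 + X 1 ^ 2 + X 2 ^ 2 from by ring]; exact hs)
      (by rw [show (1 + X 2 ^ 3 + X 1 ^ 3 : MvPolynomial (Fin 3) K) = 1 + X 1 ^ 3 + X 2 ^ 3 from by ring]; exact ht)
  -- both `2y₀ + 3y₁, 2y₀ + 3y₂ ∈ Q`: then `3 ∈ Q`
  have hdiff : (X 1 - X 2 : MvPolynomial (Fin 3) K) ∈ Q := by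
    have h : (C (3 : K) * (X 1 - X 2) : MvPolynomial (Fin 3) K) ∈ Q := by
      have h := Q.sub_mem hv1 hv2
      rwa [show (2 * X 0 + 3 * X 1 - (2 * X 0 + 3 * X 2) : MvPolynomial (Fin 3) K) = C (3 : K) * (X 1 - X 2) from by rw [hC3]; ring] at h
    exact (hQ.mem_or_mem h).resolve_left (fun h3Q => hunit h3 h3Q)
  have ha : (1 + 2 * X 1 ^ 2 : MvPolynomial (Fin 3) K) ∈ Q := by
    have h := Q.sub_mem hs (Q.mul_mem_left (X 2 + X 1) (Q.neg_mem hdiff))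
    rwa [show (1 + X 1 ^ 2 + X 2 ^ 2 - (X 2 + X 1) * -(X 1 - X 2) : MvPolynomial (Fin 3) K) = 1 + 2 * X 1 ^ 2 from by ring] at h
  have hb : (1 + 2 * X 1 ^ 3 : MvPolynomial (Fin 3) K) ∈ Q := by
    have h := Q.sub_mem ht (Q.mul_mem_left (X 2 ^ 2 + X 1 * X 2 + X 1 ^ 2) (Q.neg_mem hdiff))
    rwa [show (1 + X 1 ^ 3 + X 2 ^ 3 - (X 2 ^ 2 + X 1 * X 2 + X 1 ^ 2) * -(X 1 - X 2) : MvPolynomial (Fin 3) K) = 1 + 2 * X 1 ^ 3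
      from by ring] at h
  have hc : (X 1 - 1 : MvPolynomial (Fin 3) K) ∈ Q := by
    have h := Q.sub_mem (Q.mul_mem_left (X 1) ha) hb
    rwa [show (X 1 * (1 + 2 * X 1 ^ 2) - (1 + 2 * X 1 ^ 3) : MvPolynomial (Fin 3) K) = X 1 - 1 from by ring] at h
  have h3Q : (3 : MvPolynomial (Fin 3) K) ∈ Q := by
    have h := Q.sub_mem ha (Q.mul_mem_left (2 * (X 1 + 1)) hc)
    rwa [show (1 + 2 * X 1 ^ 2 - 2 * (X 1 + 1) * (X 1 - 1) : MvPolynomial (Fin 3) K) = 3 from by ring] at h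
  exact hunit h3 (hC3 ▸ h3Q)

/-- `(f)` is radical (the quotient is regular, hence reduced). [folklore] -/
theorem radical_span_chartEqn (h2 : (2 : K) ≠ 0) (h3 : (3 : K) ≠ 0) :
    (Ideal.span {chartEqn K}).radical = Ideal.span {chartEqn K} := by
  haveI := isRegularRing_quotient_chartEqn K h2 h3
  haveI := IsRegularRing.isReduced' (MvPolynomial (Fin 3) K ⧸ Ideal.span {chartEqn K})
  exact (Ideal.isRadical_iff_quotient_reduced _).mpr inferInstance |>.radical

attribute [local instance] MvPolynomial.gradedAlgebra ProjBaseChange.algebraBase in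
/-- **The chart rings off the vertex are regular** (`c = 1, 2, 3`). [folklore] -/
theorem isRegularRing_chartRing (h2 : (2 : K) ≠ 0) (h3 : (3 : K) ≠ 0) (c : Fin (1 + 2 + 1)) (hc : c ≠ 0) :
    IsRegularRing (ChartRing (form K) c (isHomogeneous_form K)) := by
  have hdeh : dehomogenize K c (form K) = chartEqn K := by
    have hc' : c = 1 ∨ c = 2 ∨ c = 3 := by
      fin_cases c
      · exact absurd rfl hc
      · exact Or.inl rfl
      · exact Or.inr (Or.inl rfl)
      · exact Or.inr (Or.inr rfl)
    rcases hc' with rfl | rfl | rfl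
    · exact dehomogenize_one_form K
    · exact dehomogenize_two_form K
    · exact dehomogenize_three_form K
  obtain ⟨θ, -⟩ := HypersurfaceSpecimen.exists_chartQuotEquiv (form K) (isHomogeneous_form K) c (chartEqn K) hdeh
    (radical_span_chartEqn K h2 h3)
  haveI := isRegularRing_quotient_chartEqn K h2 h3
  exact IsRegularRing.of_ringEquiv θ.symm

/-! ## `F` is prime: degree one in `x₀` with coprime coefficients -/

/-- `q ∤ c`: at `(1, i, 0)` with `i² = -1` the quadric vanishes but the cubic is `1 - i ≠ 0` (`2 ≠ 0`). [folklore] -/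
theorem not_quadric_dvd_cubes [IsAlgClosed K] (h2 : (2 : K) ≠ 0) :
    ¬ (∑ i : Fin 3, (X i : MvPolynomial (Fin 3) K) ^ 2) ∣ ∑ i : Fin 3, (X i : MvPolynomial (Fin 3) K) ^ 3 := by
  obtain ⟨ι, hι⟩ := IsAlgClosed.exists_pow_nat_eq (-1 : K) two_pos
  rintro ⟨s, hs⟩
  have hι3 : ι ^ 3 = -ι := by rw [pow_succ, hι]; ring
  have h := congrArg (MvPolynomial.eval ![(1 : K), ι, 0]) hs
  simp [Fin.sum_univ_three, hι, hι3] at h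
  -- `h : 1 - ι = 0` (up to normal form); then `ι = 1`, `ι² = 1 = -1`, `2 = 0`
  have hι1 : ι = 1 := by
    first
      | linear_combination h
      | linear_combination -h
  rw [hι1, one_pow] at hι
  exact h2 (by linear_combination hι)

/-- **`F` is prime.** In `x₀`-adic form `F = q·x₀ + c` (`finSuccEquiv`): a degree-one polynomial over the UFD `K[x₁,x₂,x₃]` whose coefficients are
coprime (`q` irreducible — a nonsingular quadric — and `q ∤ c`) is primitive, hence irreducible by Gauss's lemma (irreducible over the fraction
field, degree one), hence prime. [cite: Hartshorne1977, I Ex. 5.8] -/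
theorem prime_form [IsAlgClosed K] (h2 : (2 : K) ≠ 0) : Prime (form K) := by
  set q : MvPolynomial (Fin 3) K := ∑ i : Fin 3, (X i : MvPolynomial (Fin 3) K) ^ 2 with hq
  set cu : MvPolynomial (Fin 3) K := ∑ i : Fin 3, (X i : MvPolynomial (Fin 3) K) ^ 3 with hcu
  have hq0 : q ≠ 0 := (isNonsingularForm_sum_X_pow (n := 1) (d := 2) (by exact_mod_cast h2)).ne_zero
  have hqirr : Irreducible q :=
    (isNonsingularForm_sum_X_pow (n := 1) (d := 2) (by exact_mod_cast h2)).irreducible le_rfl (by norm_num) (isHomogeneous_quadric K)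
  -- `x₀`-adic form
  have hfs : finSuccEquiv K 3 (form K) = Polynomial.C q * Polynomial.X + Polynomial.C cu := by
    rw [form, map_add, map_mul, finSuccEquiv_X_zero]
    have hq' := ConeN.finSuccEquiv_rename_succ K (m := 1) q
    have hc' := ConeN.finSuccEquiv_rename_succ K (m := 1) cu
    rw [hq', hc', mul_comm]
  -- primitive
  have hprim : (Polynomial.C q * Polynomial.X + Polynomial.C cu).IsPrimitive := by
    intro r hr
    have hrq : r ∣ q := by
      have h := (Polynomial.C_dvd_iff_dvd_coeff r _).mp hr 1
      simpa using h
    have hrc : r ∣ cu := by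
      have h := (Polynomial.C_dvd_iff_dvd_coeff r _).mp hr 0
      simpa using h
    obtain ⟨s, hs⟩ := hrq
    rcases hqirr.isUnit_or_isUnit hs with hru | hsu
    · exact hru
    · exfalso
      obtain ⟨u, rfl⟩ := hsu
      have hqr : q ∣ r := ⟨↑u⁻¹, by rw [hs, mul_assoc, Units.mul_inv, mul_one]⟩
      exact not_quadric_dvd_cubes K h2 (hqr.trans hrc)
  -- irreducible over the fraction field (degree one), hence irreducible (Gauss), hence prime
  have hqK : algebraMap (MvPolynomial (Fin 3) K) (FractionRing (MvPolynomial (Fin 3) K)) q ≠ 0 := fun h =>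
    hq0 ((IsFractionRing.injective (MvPolynomial (Fin 3) K) (FractionRing (MvPolynomial (Fin 3) K))) (h.trans (map_zero _).symm))
  have hirrK : Irreducible (Polynomial.map (algebraMap (MvPolynomial (Fin 3) K) (FractionRing (MvPolynomial (Fin 3) K)))
      (Polynomial.C q * Polynomial.X + Polynomial.C cu)) := by
    rw [Polynomial.map_add, Polynomial.map_mul, Polynomial.map_C, Polynomial.map_X, Polynomial.map_C]
    exact Polynomial.irreducible_of_degree_eq_one (Polynomial.degree_linear hqK)
  have hirrP : Irreducible (Polynomial.C q * Polynomial.X + Polynomial.C cu) :=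
    Polynomial.IsPrimitive.irreducible_of_irreducible_map_of_injective
      (IsFractionRing.injective (MvPolynomial (Fin 3) K) (FractionRing (MvPolynomial (Fin 3) K))) hprim hirrK
  have hirr : Irreducible (form K) := by
    rw [← MulEquiv.irreducible_iff (finSuccEquiv K 3).toMulEquiv]
    change Irreducible (finSuccEquiv K 3 (form K))
    rw [hfs]
    exact hirrP
  exact hirr.prime

/-! ## EL♮ for the nodal cubic surface -/

attribute [local instance] MvPolynomial.gradedAlgebra ProjBaseChange.algebraBase in
/-- **EL♮ FOR THE ONE-NODAL CUBIC SURFACE `x₀(x₁²+x₂²+x₃²) + x₁³+x₂³+x₃³ = 0`** (`K` algebraically closed of characteristic `p ≠ 2, 3`): an instance of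
`OrdPoint.elNatAt_ordinaryPoint` with `Φ = q` (nonsingular quadric, `μ = 2`), `Ψ = c ∈ (y)³` — an ordinary double point at `[1:0:0:0]`, regular
elsewhere — and NOT a cone. [OURS · L1 W4.5b] [folklore] -/
theorem elNatAt_nodalCubic (p : ℕ) (hp : p.Prime) (K : Type) [Field K] [CharP K p] [IsAlgClosed K] (h2 : (2 : K) ≠ 0) (h3 : (3 : K) ≠ 0) :
    Theorems.EquisingularLift.ELNatAt p K 3 (hypersurface (form K)).left (hypersurfaceι (form K)).left := by
  -- `(q + c)` is radical: `q + c = F(x₀ := 1)` is irreducible (a prime form dehomogenised, not a unit since it lies in `(y)`)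
  have hmem : (∑ i : Fin 3, (X i : MvPolynomial (Fin 3) K) ^ 2) + ∑ i : Fin 3, (X i : MvPolynomial (Fin 3) K) ^ 3 ∈
      Ideal.span (Set.range (X : Fin 3 → MvPolynomial (Fin 3) K)) :=
    Ideal.add_mem _ (Ideal.sum_mem _ fun i _ => Ideal.pow_mem_of_mem _ (Ideal.subset_span (Set.mem_range_self i)) _ two_pos)
      (Ideal.sum_mem _ fun i _ => Ideal.pow_mem_of_mem _ (Ideal.subset_span (Set.mem_range_self i)) _ three_pos)
  have hnu : ¬ IsUnit ((∑ i : Fin 3, (X i : MvPolynomial (Fin 3) K) ^ 2) + ∑ i : Fin 3, (X i : MvPolynomial (Fin 3) K) ^ 3) := by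
    intro hu
    have hprime : (Ideal.span (Set.range (X : Fin 3 → MvPolynomial (Fin 3) K))).IsPrime :=
      (Ideal.Quotient.isDomain_iff_prime _).mp (ConeN.isDomain_quotient_origin K (N := 2))
    exact hprime.ne_top (Ideal.eq_top_of_isUnit_mem _ hmem hu)
  have hirr : Irreducible ((∑ i : Fin 3, (X i : MvPolynomial (Fin 3) K) ^ 2) + ∑ i : Fin 3, (X i : MvPolynomial (Fin 3) K) ^ 3) := by
    rw [← dehomogenize_zero_form] at hnu ⊢
    exact (irreducible_or_isUnit_dehomogenize (i := (0 : Fin (1 + 2 + 1))) (isHomogeneous_form K) (prime_form K h2).irreducible).resolve_right hnu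
  have hrad : (Ideal.span {(∑ i : Fin 3, (X i : MvPolynomial (Fin 3) K) ^ 2) + ∑ i : Fin 3, (X i : MvPolynomial (Fin 3) K) ^ 3}).radical =
      Ideal.span {(∑ i : Fin 3, (X i : MvPolynomial (Fin 3) K) ^ 2) + ∑ i : Fin 3, (X i : MvPolynomial (Fin 3) K) ^ 3} :=
    ((Ideal.span_singleton_prime hirr.ne_zero).mpr hirr.prime).radical
  exact OrdPoint.elNatAt_ordinaryPoint p hp K (form K) (isHomogeneous_form K) (prime_form K h2) (form_mem_span K)
    (∑ i : Fin 3, (X i : MvPolynomial (Fin 3) K) ^ 2) (∑ i : Fin 3, (X i : MvPolynomial (Fin 3) K) ^ 3) (isHomogeneous_quadric K)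
    (isNonsingularForm_sum_X_pow (n := 1) (d := 2) (by exact_mod_cast h2)) (cubes_mem_pow K) (dehomogenize_zero_form K) hrad
    (fun c hc => isRegularRing_chartRing K h2 h3 c hc)

end NodalCubic

end Summit.ResolutionOfSingularities.ResolutionOfSingularities.Cruxes.EquisingularLiftNat.Sections

end
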